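import Summits.ValiantsHypothesis.ValiantsHypothesis.Theorems.DefinabilityGapPatternPermanent
import HarnessLib

/-!
# DefinabilityGap — ZEROED BLOCK PERMANENTS: the KI generator with the cells of some blocks set to `0`

Route `route-ValiantsHypothesis-DefinabilityGap` (decomp-valiant cycle 1, lens 5), the engine of the zero-out induction of
`DefinabilityGapSparsityRung` (size road, census cells W5 / W19 of `KIPlantedHitting` = stmt-ValiantsHypothesis-23547;
read-once leaf F4 / W10 = stmt-ValiantsHypothesis-23704).

`zeroOut F` substitutes `0` for the seed variables `y_x`, `x ∈ F ⊆ 𝔽_q²`; the ZEROED BLOCK PERMANENT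
`Q^F_c := zeroOut F (P_c)` is the pattern permanent of block `c` for the pattern `patOf F c` that `F` cuts out of the `m²`
cells of `c`, transported along `cellEmb c` (`kiPerZ_eq_rename`). Since two blocks of the quadratic-curve design share
`≤ 2` cells, zeroing ALL cells of a block `c₀` kills `Q_{c₀}` and adds at most TWO zeros to every other block
(`card_patOf_union_cells_le`). As long as a block has seen `≤ m − 2` zeros ("small pattern"):
* `kiPerZ_prime`: `Q^F_c` is a prime of `ℂ[y]` (`perPat_prime` + `prime_rename_of_injective`);
* `not_associated_kiPerZ` / `kiPerZ_dvd_iff` (`m ≥ 3`): distinct blocks give non-associated primes (an avoiding permutation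
  monomial of `c` lies in no other block);
* `emultiplicity_kiPerZ_prod_pow`: the `Q^F_{c₀}`-adic valuation of `∏_c (Q^F_c)^{κ_c}` is `κ_{c₀}`;
* `kiPerZ_two_term`: NO two-term relation `a·∏ (Q^F_c)^{κ_c} + b·∏ (Q^F_c)^{κ'_c} = 0` (`κ ≠ κ'`) among zeroed block
  permanents with small patterns, unless `a = b = 0` — the base of the induction.
0 sorry.
-/

noncomputable section

open MvPolynomial
open Literature.Computability.AlgebraicComplexity Literature.Computability.MetaComplexity

namespace Summit.ValiantsHypothesis.ValiantsHypothesis.Theorems.DefinabilityGapZeroedBlocks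

open Summit.ValiantsHypothesis.ValiantsHypothesis.Theorems.DefinabilityGapAffineRung
open Summit.ValiantsHypothesis.ValiantsHypothesis.Theorems.DefinabilityGapShiftedPrimes
open Summit.ValiantsHypothesis.ValiantsHypothesis.Theorems.DefinabilityGapPatternPermanent

variable {m : ℕ}

/-! ## 1. Zeroing seed variables; cells and patterns -/

/-- Substitute `0` for the seed variables in `F`. [this file] -/
def zeroOut (m : ℕ) (F : Finset (Fin (qOf m) × Fin (qOf m))) :
    MvPolynomial (Fin (qOf m) × Fin (qOf m)) ℂ →ₐ[ℂ] MvPolynomial (Fin (qOf m) × Fin (qOf m)) ℂ :=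
  aeval fun x => if x ∈ F then 0 else X x

/-- `zeroOut` on variables. [this file] -/
theorem zeroOut_X (F : Finset (Fin (qOf m) × Fin (qOf m))) (x : Fin (qOf m) × Fin (qOf m)) :
    zeroOut m F (X x) = if x ∈ F then 0 else X x := by
  rw [zeroOut, aeval_X]

/-- Zeroing in two steps. [this file] -/
theorem zeroOut_zeroOut (F G : Finset (Fin (qOf m) × Fin (qOf m))) (p : MvPolynomial (Fin (qOf m) × Fin (qOf m)) ℂ) :
    zeroOut m G (zeroOut m F p) = zeroOut m (F ∪ G) p := by
  have : (zeroOut m G).comp (zeroOut m F) = zeroOut m (F ∪ G) := by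
    refine MvPolynomial.algHom_ext fun x => ?_
    rw [AlgHom.comp_apply, zeroOut_X, zeroOut_X]
    by_cases hx : x ∈ F
    · rw [if_pos hx, map_zero, if_pos (Finset.mem_union_left _ hx)]
    · rw [if_neg hx, zeroOut_X]
      by_cases hx' : x ∈ G
      · rw [if_pos hx', if_pos (Finset.mem_union_right _ hx')]
      · rw [if_neg hx', if_neg (by rw [Finset.mem_union]; tauto)]
  rw [← AlgHom.comp_apply, this]

/-- Zeroing nothing. [this file] -/
theorem zeroOut_empty (p : MvPolynomial (Fin (qOf m) × Fin (qOf m)) ℂ) : zeroOut m ∅ p = p := by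
  have : zeroOut m ∅ = AlgHom.id ℂ _ := MvPolynomial.algHom_ext fun x => by
    rw [zeroOut_X, if_neg (Finset.notMem_empty _), AlgHom.id_apply]
  rw [this, AlgHom.id_apply]

/-- `zeroOut` commutes past a substitution: `zeroOut G (D(f)) = D(zeroOut G ∘ f)`. [this file] -/
theorem zeroOut_bind₁ {τ : Type*} (G : Finset (Fin (qOf m) × Fin (qOf m)))
    (f : τ → MvPolynomial (Fin (qOf m) × Fin (qOf m)) ℂ) (D : MvPolynomial τ ℂ) :
    zeroOut m G (bind₁ f D) = bind₁ (fun i => zeroOut m G (f i)) D := by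
  have : (zeroOut m G).comp (bind₁ f) = bind₁ fun i => zeroOut m G (f i) :=
    MvPolynomial.algHom_ext fun i => by rw [AlgHom.comp_apply, bind₁_X_right, bind₁_X_right]
  rw [← AlgHom.comp_apply, this]

/-- The `m²` cells of block `c` in the seed universe. [this file] -/
def cells (m : ℕ) (c : Fin 3 → Fin (qOf m)) : Finset (Fin (qOf m) × Fin (qOf m)) := Finset.univ.map (cellEmb m c)

/-- The cells of `c` lie on the curve `S_c`. [this file] -/
theorem cells_subset (c : Fin 3 → Fin (qOf m)) : cells m c ⊆ Finset.univ.map (quadDesign m c) := by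
  intro x hx
  obtain ⟨rc, -, rfl⟩ := Finset.mem_map.1 hx
  exact Finset.mem_map.2 ⟨permPad (sq_le_qOf m) rc, Finset.mem_univ _, rfl⟩

/-- **Two blocks share at most two cells** (quadratic-curve design). [this file] -/
theorem card_cells_inter_le {c c' : Fin 3 → Fin (qOf m)} (hcc' : c ≠ c') : (cells m c ∩ cells m c').card ≤ 2 :=
  (Finset.card_le_card (Finset.inter_subset_inter (cells_subset c) (cells_subset c'))).trans
    (quadDesign_isNWDesign m hcc')

/-- The zero PATTERN that `F` cuts out of the cells of block `c` (in matrix coordinates). [this file] -/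
def patOf (m : ℕ) (F : Finset (Fin (qOf m) × Fin (qOf m))) (c : Fin 3 → Fin (qOf m)) : Finset (Fin m × Fin m) :=
  Finset.univ.filter fun rc => cellEmb m c rc ∈ F

/-- Membership in the pattern. [this file] -/
theorem mem_patOf {F : Finset (Fin (qOf m) × Fin (qOf m))} {c : Fin 3 → Fin (qOf m)} {rc : Fin m × Fin m} :
    rc ∈ patOf m F c ↔ cellEmb m c rc ∈ F := by
  simp [patOf]

/-- The pattern, transported back, is `cells c ∩ F`. [this file] -/
theorem map_patOf (F : Finset (Fin (qOf m) × Fin (qOf m))) (c : Fin 3 → Fin (qOf m)) :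
    (patOf m F c).map (cellEmb m c) = cells m c ∩ F := by
  ext x
  simp only [Finset.mem_map, mem_patOf, cells, Finset.mem_inter, Finset.mem_univ, true_and]
  constructor
  · rintro ⟨rc, hrc, rfl⟩
    exact ⟨⟨rc, rfl⟩, hrc⟩
  · rintro ⟨⟨rc, rfl⟩, hx⟩
    exact ⟨rc, hx, rfl⟩

/-- The size of the pattern is the number of zeroed cells of the block. [this file] -/
theorem card_patOf (F : Finset (Fin (qOf m) × Fin (qOf m))) (c : Fin 3 → Fin (qOf m)) :
    (patOf m F c).card = (cells m c ∩ F).card := by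
  rw [← map_patOf, Finset.card_map]

/-- No zeros: empty pattern. [this file] -/
theorem patOf_empty (c : Fin 3 → Fin (qOf m)) : patOf m ∅ c = ∅ := by
  ext rc
  simp [mem_patOf]

/-- Patterns of a union. [this file] -/
theorem patOf_union (F G : Finset (Fin (qOf m) × Fin (qOf m))) (c : Fin 3 → Fin (qOf m)) :
    patOf m (F ∪ G) c = patOf m F c ∪ patOf m G c := by
  ext rc
  simp only [mem_patOf, Finset.mem_union]

/-- Zeroing all cells of `c`: the full pattern. [this file] -/
theorem patOf_eq_univ_of_subset {F : Finset (Fin (qOf m) × Fin (qOf m))} {c : Fin 3 → Fin (qOf m)}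
    (h : cells m c ⊆ F) : patOf m F c = Finset.univ := by
  ext rc
  simp only [mem_patOf, Finset.mem_univ, iff_true]
  exact h (Finset.mem_map_of_mem _ (Finset.mem_univ rc))

/-- **Budget accumulation**: zeroing the cells of ANOTHER block adds at most two zeros to the pattern of `c`. [this file] -/
theorem card_patOf_union_cells_le {c c' : Fin 3 → Fin (qOf m)} (hcc' : c ≠ c')
    (F : Finset (Fin (qOf m) × Fin (qOf m))) : (patOf m (F ∪ cells m c') c).card ≤ (patOf m F c).card + 2 := by
  rw [patOf_union]
  refine (Finset.card_union_le _ _).trans ?_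
  have : (patOf m (cells m c') c).card ≤ 2 := by rw [card_patOf]; exact card_cells_inter_le hcc'
  omega

/-! ## 2. Zeroed block permanents are non-associated primes -/

/-- The ZEROED BLOCK PERMANENT `Q^F_c := P_c` with the seed variables in `F` set to `0`. [this file] -/
def kiPerZ (m : ℕ) (F : Finset (Fin (qOf m) × Fin (qOf m))) (c : Fin 3 → Fin (qOf m)) :
    MvPolynomial (Fin (qOf m) × Fin (qOf m)) ℂ :=
  zeroOut m F (kiPer m c)

/-- `Q^F_c` is the pattern permanent of `patOf F c`, transported along `cellEmb c`. [this file] -/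
theorem kiPerZ_eq_rename (F : Finset (Fin (qOf m) × Fin (qOf m))) (c : Fin 3 → Fin (qOf m)) :
    kiPerZ m F c = rename (cellEmb m c) (perPat ℂ (patOf m F c)) := by
  rw [kiPerZ, kiPer_eq_rename_cellEmb, ← killVars_perPoly]
  have : (zeroOut m F).comp (rename (cellEmb m c)) =
      (rename (cellEmb m c)).comp (killVars ℂ (patOf m F c)) := by
    refine MvPolynomial.algHom_ext fun rc => ?_
    rw [AlgHom.comp_apply, AlgHom.comp_apply, rename_X, zeroOut_X, killVars_X]
    by_cases hrc : cellEmb m c rc ∈ F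
    · rw [if_pos hrc, if_pos (mem_patOf.2 hrc), map_zero]
    · rw [if_neg hrc, if_neg fun h => hrc (mem_patOf.1 h), rename_X]
  rw [← AlgHom.comp_apply, this, AlgHom.comp_apply]

/-- No zeros: `Q^∅_c = P_c`. [this file] -/
theorem kiPerZ_empty (c : Fin 3 → Fin (qOf m)) : kiPerZ m ∅ c = kiPer m c :=
  zeroOut_empty _

/-- Zeroing more variables. [this file] -/
theorem zeroOut_kiPerZ (F G : Finset (Fin (qOf m) × Fin (qOf m))) (c : Fin 3 → Fin (qOf m)) :
    zeroOut m G (kiPerZ m F c) = kiPerZ m (F ∪ G) c :=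
  zeroOut_zeroOut F G _

/-- Zeroing every cell of `c` kills `Q_c`. [this file] -/
theorem kiPerZ_eq_zero (hm : 1 ≤ m) {F : Finset (Fin (qOf m) × Fin (qOf m))} {c : Fin 3 → Fin (qOf m)}
    (h : cells m c ⊆ F) : kiPerZ m F c = 0 := by
  haveI : Nonempty (Fin m) := ⟨⟨0, hm⟩⟩
  rw [kiPerZ_eq_rename, patOf_eq_univ_of_subset h, perPat_univ, map_zero]

/-- **`Q^F_c` is prime** as long as block `c` has seen at most `m − 2` zeros. [this file] -/
theorem kiPerZ_prime {F : Finset (Fin (qOf m) × Fin (qOf m))} {c : Fin 3 → Fin (qOf m)}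
    (hF : (patOf m F c).card + 2 ≤ m) : Prime (kiPerZ m F c) := by
  rw [kiPerZ_eq_rename]
  exact prime_rename_of_injective (cellEmb m c).injective (perPat_prime _ (by rwa [Fintype.card_fin]))

/-- … in particular non-zero. [this file] -/
theorem kiPerZ_ne_zero {F : Finset (Fin (qOf m) × Fin (qOf m))} {c : Fin 3 → Fin (qOf m)}
    (hF : (patOf m F c).card + 2 ≤ m) : kiPerZ m F c ≠ 0 :=
  (kiPerZ_prime hF).ne_zero

/-- The transported monomial of a permutation `π` of block `c` has coefficient `[π avoids the pattern]` in `Q^F_c`. [this file] -/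
theorem coeff_perm_kiPerZ_self (F : Finset (Fin (qOf m) × Fin (qOf m))) (c : Fin 3 → Fin (qOf m))
    (π : Equiv.Perm (Fin m)) :
    coeff (Finsupp.mapDomain (cellEmb m c) (permMonomial π)) (kiPerZ m F c) =
      if Avoids (patOf m F c) π then 1 else 0 := by
  rw [kiPerZ_eq_rename, coeff_rename_mapDomain _ (cellEmb m c).injective, coeff_permMonomial_perPat]
  convert rfl

/-- … and coefficient `0` in the zeroed permanent of every OTHER block (`m ≥ 3`; design intersections `≤ 2`). [this file] -/
theorem coeff_perm_kiPerZ_ne (hm : 3 ≤ m) {c c' : Fin 3 → Fin (qOf m)} (hcc' : c' ≠ c) (π : Equiv.Perm (Fin m))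
    (F : Finset (Fin (qOf m) × Fin (qOf m))) :
    coeff (Finsupp.mapDomain (cellEmb m c) (permMonomial π)) (kiPerZ m F c') = 0 := by
  by_contra h
  rw [kiPerZ_eq_rename] at h
  obtain ⟨u, hu, hcoeff⟩ := coeff_rename_ne_zero _ _ _ h
  obtain ⟨ρ, -, rfl⟩ := exists_of_coeff_perPat_ne_zero ℂ hcoeff
  have h1 : (Finsupp.mapDomain (cellEmb m c) (permMonomial π)).support ⊆ Finset.univ.map (quadDesign m c) :=
    support_mapDomain_cellEmb_subset m c _
  have h2 : (Finsupp.mapDomain (cellEmb m c) (permMonomial π)).support ⊆ Finset.univ.map (quadDesign m c') := by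
    rw [← hu]
    exact support_mapDomain_cellEmb_subset m c' _
  have hle := (Finset.card_le_card (Finset.subset_inter h2 h1)).trans (quadDesign_isNWDesign m hcc')
  rw [Finsupp.mapDomain_support_of_injective (cellEmb m c).injective,
    Finset.card_image_of_injective _ (cellEmb m c).injective, card_support_permMonomial, Fintype.card_fin] at hle
  omega

/-- **Zeroed permanents of distinct blocks are non-associated** (`m ≥ 3`, pattern of `c` small). [this file] -/
theorem not_associated_kiPerZ (hm : 3 ≤ m) {F : Finset (Fin (qOf m) × Fin (qOf m))} {c c' : Fin 3 → Fin (qOf m)}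
    (hne : c ≠ c') (hF : (patOf m F c).card + 2 ≤ m) : ¬ Associated (kiPerZ m F c) (kiPerZ m F c') := by
  classical
  rintro ⟨u, hu⟩
  obtain ⟨r, hr, hur⟩ := (MvPolynomial.isUnit_iff_eq_C_of_isReduced).1 u.isUnit
  obtain ⟨π₀, hπ₀⟩ := exists_avoids (patOf m F c) (by rwa [Fintype.card_fin])
  have key := congrArg (coeff (Finsupp.mapDomain (cellEmb m c) (permMonomial π₀))) hu
  rw [hur, mul_comm, coeff_C_mul, coeff_perm_kiPerZ_self, if_pos hπ₀, mul_one,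
    coeff_perm_kiPerZ_ne hm hne.symm π₀ F] at key
  exact hr.ne_zero key

/-- Hence `Q^F_c ∣ Q^F_{c'}` iff `c = c'` (both patterns small). [this file] -/
theorem kiPerZ_dvd_iff (hm : 3 ≤ m) {F : Finset (Fin (qOf m) × Fin (qOf m))} {c c' : Fin 3 → Fin (qOf m)}
    (hF : (patOf m F c).card + 2 ≤ m) (hF' : (patOf m F c').card + 2 ≤ m) :
    kiPerZ m F c ∣ kiPerZ m F c' ↔ c = c' := by
  constructor
  · intro h
    by_contra hne
    exact not_associated_kiPerZ hm hne hF
      (((kiPerZ_prime hF).irreducible.dvd_irreducible_iff_associated (kiPerZ_prime hF').irreducible).1 h)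
  · rintro rfl
    exact dvd_rfl

/-! ## 3. Valuations; no two-term relations -/

/-- The `Q_{c₀}`-adic valuation of `Q_c` is `[c₀ = c]`. [this file] -/
theorem emultiplicity_kiPerZ (hm : 3 ≤ m) {F : Finset (Fin (qOf m) × Fin (qOf m))} (c₀ c : Fin 3 → Fin (qOf m))
    (h₀ : (patOf m F c₀).card + 2 ≤ m) (hc : (patOf m F c).card + 2 ≤ m) :
    emultiplicity (kiPerZ m F c₀) (kiPerZ m F c) = if c₀ = c then 1 else 0 := by
  have hp := kiPerZ_prime h₀
  split_ifs with h
  · subst h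
    exact (FiniteMultiplicity.of_prime_left hp hp.ne_zero).emultiplicity_self
  · exact emultiplicity_eq_zero.2 fun hd => h ((kiPerZ_dvd_iff hm h₀ hc).1 hd)

/-- … and of its powers. [this file] -/
theorem emultiplicity_kiPerZ_pow (hm : 3 ≤ m) {F : Finset (Fin (qOf m) × Fin (qOf m))} (c₀ c : Fin 3 → Fin (qOf m))
    (h₀ : (patOf m F c₀).card + 2 ≤ m) (hc : (patOf m F c).card + 2 ≤ m) (k : ℕ) :
    emultiplicity (kiPerZ m F c₀) (kiPerZ m F c ^ k) = if c₀ = c then (k : ℕ∞) else 0 := by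
  rw [emultiplicity_pow (kiPerZ_prime h₀), emultiplicity_kiPerZ hm c₀ c h₀ hc]
  split_ifs <;> simp

/-- **Valuation of a monomial in zeroed block permanents**: `v_{Q_{c₀}}(∏_c Q_c^{κ_c}) = κ_{c₀}`. [this file] -/
theorem emultiplicity_kiPerZ_prod_pow (hm : 3 ≤ m) {F : Finset (Fin (qOf m) × Fin (qOf m))}
    (κ : (Fin 3 → Fin (qOf m)) →₀ ℕ) (hκ : ∀ c ∈ κ.support, (patOf m F c).card + 2 ≤ m)
    (c₀ : Fin 3 → Fin (qOf m)) (h₀ : (patOf m F c₀).card + 2 ≤ m) :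
    emultiplicity (kiPerZ m F c₀) (∏ c ∈ κ.support, kiPerZ m F c ^ κ c) = (κ c₀ : ℕ∞) := by
  classical
  rw [Finset.emultiplicity_prod (kiPerZ_prime h₀),
    Finset.sum_congr rfl fun c hc => emultiplicity_kiPerZ_pow hm c₀ c h₀ (hκ c hc) (κ c), Finset.sum_ite_eq]
  split_ifs with hmem
  · rfl
  · rw [Finsupp.notMem_support_iff.1 hmem]
    rfl

/-- Valuation of a scaled monomial. [this file] -/
theorem emultiplicity_kiPerZ_C_mul_prod_pow (hm : 3 ≤ m) {F : Finset (Fin (qOf m) × Fin (qOf m))}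
    (κ : (Fin 3 → Fin (qOf m)) →₀ ℕ) (hκ : ∀ c ∈ κ.support, (patOf m F c).card + 2 ≤ m)
    (c₀ : Fin 3 → Fin (qOf m)) (h₀ : (patOf m F c₀).card + 2 ≤ m) {r : ℂ} (hr : r ≠ 0) :
    emultiplicity (kiPerZ m F c₀) (C r * ∏ c ∈ κ.support, kiPerZ m F c ^ κ c) = (κ c₀ : ℕ∞) := by
  have hp := kiPerZ_prime h₀
  have hunit : IsUnit (C r : MvPolynomial (Fin (qOf m) × Fin (qOf m)) ℂ) := (IsUnit.mk0 r hr).map C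
  rw [emultiplicity_mul hp, emultiplicity_eq_zero.2 fun hd => hp.not_unit (isUnit_of_dvd_unit hd hunit), zero_add,
    emultiplicity_kiPerZ_prod_pow hm κ hκ c₀ h₀]

/-- A monomial in zeroed block permanents with small patterns is non-zero. [this file] -/
theorem prod_kiPerZ_pow_ne_zero {F : Finset (Fin (qOf m) × Fin (qOf m))} (κ : (Fin 3 → Fin (qOf m)) →₀ ℕ)
    (hκ : ∀ c ∈ κ.support, (patOf m F c).card + 2 ≤ m) : ∏ c ∈ κ.support, kiPerZ m F c ^ κ c ≠ 0 :=
  Finset.prod_ne_zero_iff.2 fun c hc => pow_ne_zero _ (kiPerZ_ne_zero (hκ c hc))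

/-- **No two-term relations** among zeroed block permanents with small patterns (`m ≥ 3`): if
`a·∏ Q_c^{κ_c} + b·∏ Q_c^{κ'_c} = 0` with `κ ≠ κ'` then `a = b = 0` (compare `Q_{c₀}`-adic valuations at a block where
`κ` and `κ'` differ). [this file] -/
theorem kiPerZ_two_term (hm : 3 ≤ m) {F : Finset (Fin (qOf m) × Fin (qOf m))} {κ κ' : (Fin 3 → Fin (qOf m)) →₀ ℕ}
    (hne : κ ≠ κ') (hκ : ∀ c ∈ κ.support, (patOf m F c).card + 2 ≤ m)
    (hκ' : ∀ c ∈ κ'.support, (patOf m F c).card + 2 ≤ m) {a b : ℂ}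
    (h : bind₁ (kiPerZ m F) (monomial κ a + monomial κ' b) = 0) : a = 0 ∧ b = 0 := by
  classical
  rw [map_add, bind₁_monomial, bind₁_monomial] at h
  have hP := prod_kiPerZ_pow_ne_zero κ hκ
  have hP' := prod_kiPerZ_pow_ne_zero κ' hκ'
  by_cases ha : a = 0
  · rw [ha, C_0, zero_mul, zero_add] at h
    rcases mul_eq_zero.1 h with h1 | h1
    · exact ⟨ha, (C_eq_zero).1 h1⟩
    · exact absurd h1 hP'
  by_cases hb : b = 0
  · rw [hb, C_0, zero_mul, add_zero] at h
    rcases mul_eq_zero.1 h with h1 | h1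
    · exact absurd ((C_eq_zero).1 h1) ha
    · exact absurd h1 hP
  exfalso
  obtain ⟨c₀, hc₀⟩ := DFunLike.ne_iff.1 hne
  have h₀ : (patOf m F c₀).card + 2 ≤ m := by
    by_cases h0 : κ c₀ = 0
    · exact hκ' c₀ (Finsupp.mem_support_iff.2 fun h' => hc₀ (by rw [h0, h']))
    · exact hκ c₀ (Finsupp.mem_support_iff.2 h0)
  have heq := eq_neg_of_add_eq_zero_left h
  have v1 := emultiplicity_kiPerZ_C_mul_prod_pow hm κ hκ c₀ h₀ ha
  have v2 := emultiplicity_kiPerZ_C_mul_prod_pow hm κ' hκ' c₀ h₀ hb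
  rw [heq, emultiplicity_neg, v2] at v1
  exact hc₀ (by exact_mod_cast v1.symm)

end Summit.ValiantsHypothesis.ValiantsHypothesis.Theorems.DefinabilityGapZeroedBlocks
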